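import Literature.Probability.Percolation.TriHexBallDomain
import HarnessLib

/-!
# A seven-marked discrete domain on eight sites: the rhombus `R(2,4)`

Topic `Literature/Probability/Percolation`; family `crit-perc`. A second family of concrete marked discrete domains of
Bollobás–Riordan (*Percolation* (2006), Ch. 7 §7.2.2, pp. 192–193; tree `TriMarkedDomain`), after the hexagons `hexBall2Five` /
`hexBall1Five` of `TriHexBallDomain.lean`: the 2 × 4 RHOMBUS of sites `rhombus24 = {(a, b) : a ∈ {−1, 0}, b ∈ {−1, 0, 1, 2}}` (8 sites,
boundary cycle of 22 darts, 8 markable positions `0, 4, 7, 9, 11, 15, 18, 20`), with SEVEN marks — the smallest site count on which seven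
marks fit. Two markings are constructed: `rhombus24SevenA` (positions `0,4,7,9,11,15,18`) and `rhombus24SevenB` (positions
`0,4,7,9,11,18,20`). Purpose: these are the two marked domains of the lane's numerical certificate for the NECESSITY of
Khristoforov–Smirnov's tripod law at seven disorders (HOME `pub-sawmu-b-engine-2/gen17/nec7/FINDING-NEC7-SMALL-CERTIFICATE.md`: three
two-corner faces with `2^6` cores each) — a kernel census on them is `64` configurations per face.

Construction (the `hexBall1Five` template): `TriMarkedDomain.ofOneBlock` (`TriOneBlock.lean`) from (1) connectivity through the two hubs
`(−1, 0)` and `(0, 1)`, (2) connectivity of the complement (far sites by `pathIn_compl_farSite`; the ring `triBall 5 ∖ rhombus24` escapes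
along a straight six-step ray, a finite `decide`), (3) one-block ring patterns on a box containing the rhombus and its outer boundary
(`decide`); then `IsTriDisc.rebase` to the base dart `((−1,−1), (−2,−1))` and the mark fields by `decide`.

## References
* B. Bollobás, O. Riordan, *Percolation*, Cambridge University Press (2006), Ch. 7 §7.2.2, pp. 192–193.

## Mathlib / tree
Tree: `TriHexBallDomain.lean` (template), `TriOneBlock.lean` (`OneBlockAt`, `TriMarkedDomain.ofOneBlock`), `TriLatticeFill.lean`
(`frameRad`, `farSite`, `pathIn_compl_farSite`, `far_of_not_mem_triBall`), `TriDiscShelling.lean` (`IsTriDisc.rebase`, `triDir`,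
`triGraph_adj_add_triDir`), `TriDiscreteDomain.lean` (`TriMarkedDomain`, `triBdryIter`), `SitePaths.lean` (`PathIn`). Mathlib: `decide`.
-/

open Finset Literature.Probability.LatticeModels

noncomputable section

namespace Literature.Probability.Percolation

set_option maxRecDepth 400000

/-- **the 2 × 4 rhombus** `{(a, b) : a ∈ {−1, 0}, b ∈ {−1, 0, 1, 2}}` (8 sites). [cite: BollobasRiordan2006, Ch. 7 §7.2.2 p. 192] -/
def rhombus24 : Finset (Site 2) :=
  {![-1, -1], ![-1, 0], ![-1, 1], ![-1, 2], ![0, -1], ![0, 0], ![0, 1], ![0, 2]}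

/-- Every site of the rhombus is one of the two hubs `(−1,0)`, `(0,1)` or adjacent to one of them (finite check). [folklore] -/
private theorem rhombus24_hub : ∀ p ∈ rhombus24, p = ![-1, 0] ∨ p = ![0, 1] ∨ triGraph.Adj p ![-1, 0] ∨ triGraph.Adj p ![0, 1] := by
  decide

/-- The two hubs are joined through `(0, 0)` inside the rhombus (finite check). [folklore] -/
private theorem rhombus24_hubs_adj : triGraph.Adj (![-1, 0] : Site 2) ![0, 0] ∧ triGraph.Adj (![0, 0] : Site 2) ![0, 1] ∧
    (![-1, 0] : Site 2) ∈ rhombus24 ∧ (![0, 0] : Site 2) ∈ rhombus24 ∧ (![0, 1] : Site 2) ∈ rhombus24 := by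
  decide

/-- `rhombus24` is connected (through the hubs). [folklore] -/
private theorem rhombus24_pathIn : ∀ p ∈ rhombus24, ∀ q ∈ rhombus24, PathIn triGraph (↑rhombus24 : Set (Site 2)) p q := by
  obtain ⟨a1, a2, m1, m0, m2⟩ := rhombus24_hubs_adj
  have c1 : (![-1, 0] : Site 2) ∈ (↑rhombus24 : Set (Site 2)) := mem_coe.2 m1
  have c0 : (![0, 0] : Site 2) ∈ (↑rhombus24 : Set (Site 2)) := mem_coe.2 m0
  have c2 : (![0, 1] : Site 2) ∈ (↑rhombus24 : Set (Site 2)) := mem_coe.2 m2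
  have h12 : PathIn triGraph (↑rhombus24 : Set (Site 2)) ![-1, 0] ![0, 1] :=
    (PathIn.of_adj c1 c0 a1).trans (PathIn.of_adj c0 c2 a2)
  have key : ∀ p ∈ rhombus24, PathIn triGraph (↑rhombus24 : Set (Site 2)) p ![-1, 0] := by
    intro p hp
    rcases rhombus24_hub p hp with rfl | rfl | h | h
    · exact PathIn.refl c1
    · exact h12.symm
    · exact PathIn.of_adj (mem_coe.2 hp) c1 h
    · exact (PathIn.of_adj (mem_coe.2 hp) c2 h).trans h12.symm
  intro p hp q hq
  exact (key p hp).trans (key q hq).symm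

/-- `frameRad rhombus24 = 5`. [folklore] -/
private theorem frameRad_rhombus24 : frameRad rhombus24 = 5 := by
  decide

/-- a straight ray of `n` steps in direction `triDir j` avoiding `S` is a path in the complement. [folklore] -/
private theorem rhombusRay_pathIn (S : Finset (Site 2)) (o : Site 2) (j : Fin 6) :
    ∀ n : ℕ, (∀ s : ℕ, s ≤ n → o + (s : ℤ) • triDir j ∉ S) →
      PathIn triGraph ((↑S : Set (Site 2))ᶜ) o (o + (n : ℤ) • triDir j) := by
  intro n
  induction n with
  | zero =>
    intro h
    have h0 := h 0 le_rfl
    simp only [Nat.cast_zero, zero_smul, add_zero] at h0 ⊢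
    exact PathIn.refl (by rw [Set.mem_compl_iff, mem_coe]; exact h0)
  | succ n ih =>
    intro h
    have hn : PathIn triGraph ((↑S : Set (Site 2))ᶜ) o (o + (n : ℤ) • triDir j) := ih fun s hs => h s (by omega)
    have m1 : o + (n : ℤ) • triDir j ∈ ((↑S : Set (Site 2))ᶜ) := by rw [Set.mem_compl_iff, mem_coe]; exact h n (by omega)
    have m2 : o + ((n + 1 : ℕ) : ℤ) • triDir j ∈ ((↑S : Set (Site 2))ᶜ) := by
      rw [Set.mem_compl_iff, mem_coe]; exact h (n + 1) le_rfl
    have hadj : triGraph.Adj (o + (n : ℤ) • triDir j) (o + ((n + 1 : ℕ) : ℤ) • triDir j) := by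
      have e : o + ((n + 1 : ℕ) : ℤ) • triDir j = (o + (n : ℤ) • triDir j) + triDir j := by
        push_cast; rw [add_smul, one_smul, add_assoc]
      rw [e]; exact triGraph_adj_add_triDir _ j
    exact hn.trans (PathIn.of_adj m1 m2 hadj)

/-- Every site of the ring `triBall 5 ∖ rhombus24` escapes along a straight six-step ray avoiding the rhombus and leaving `triBall 5`
(finite check). [folklore] -/
private theorem rhombus24_escape : ∀ o ∈ triBall 5 \ rhombus24, ∃ j : Fin 6,
    (∀ s ∈ Finset.range 7, o + (s : ℤ) • triDir j ∉ rhombus24) ∧ o + (6 : ℤ) • triDir j ∉ triBall 5 := by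
  decide

/-- The complement of `rhombus24` in `𝕋` is connected. [folklore] -/
private theorem rhombus24_pathIn_compl : ∀ o ∉ rhombus24, ∀ o' ∉ rhombus24,
    PathIn triGraph ((↑rhombus24 : Set (Site 2))ᶜ) o o' := by
  have far : ∀ x : Site 2, x ∉ triBall 5 → PathIn triGraph ((↑rhombus24 : Set (Site 2))ᶜ) x (farSite rhombus24) := by
    intro x hx
    have hx' : x ∉ triBall (frameRad rhombus24) := by rw [frameRad_rhombus24]; exact hx
    exact pathIn_compl_farSite (far_of_not_mem_triBall hx')
  have key : ∀ o ∉ rhombus24, PathIn triGraph ((↑rhombus24 : Set (Site 2))ᶜ) o (farSite rhombus24) := by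
    intro o ho
    by_cases h5 : o ∈ triBall 5
    · obtain ⟨j, hray, hout⟩ := rhombus24_escape o (mem_sdiff.2 ⟨h5, ho⟩)
      have hp := rhombusRay_pathIn rhombus24 o j 6 fun s hs => hray s (Finset.mem_range.2 (by omega))
      exact hp.trans (far _ (by exact_mod_cast hout))
    · exact far o h5
  intro o ho o' ho'
  exact (key o ho).trans (key o' ho').symm

/-- a box containing the rhombus and its outer boundary. [folklore] -/
private def rhombus24Box : Finset (Site 2) := triBall 4

/-- The rhombus and its outer boundary lie in the box (finite check). [folklore] -/
private theorem rhombus24_subset_box : rhombus24 ⊆ rhombus24Box ∧ triOuterBdry rhombus24 ⊆ rhombus24Box := by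
  unfold rhombus24Box; constructor <;> decide

/-- One-block ring patterns at every site of the box (finite check). [folklore] -/
private theorem rhombus24_oneBlock_box : ∀ x ∈ rhombus24Box, OneBlockAt rhombus24 x := by
  unfold OneBlockAt rhombus24Box; decide

/-- One-block ring patterns at every site of the rhombus and of its outer boundary. [folklore] -/
private theorem rhombus24_oneBlock : ∀ x, x ∈ rhombus24 ∨ x ∈ triOuterBdry rhombus24 → OneBlockAt rhombus24 x := by
  intro x hx
  rcases hx with hx | hx
  · exact rhombus24_oneBlock_box x (rhombus24_subset_box.1 hx)
  · exact rhombus24_oneBlock_box x (rhombus24_subset_box.2 hx)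

/-- The unmarked discrete domain on `rhombus24`. [folklore] -/
private def rhombus24Domain₀ : TriMarkedDomain 0 :=
  TriMarkedDomain.ofOneBlock rhombus24 ⟨![0, 0], by decide⟩ rhombus24_pathIn rhombus24_pathIn_compl rhombus24_oneBlock

/-- The base dart of the marked rhombus: from the corner site `(−1,−1)` to its second outside neighbour `(−2,−1)`.
[cite: BollobasRiordan2006, Ch. 7 §7.2.2 p. 193] -/
def rhombus24Base : Site 2 × Site 2 := (![-1, -1], ![-2, -1])

/-- marking A: positions `0, 4, 7, 9, 11, 15, 18` of the 22-dart boundary cycle. [cite: BollobasRiordan2006, Ch. 7 §7.2.2 p. 193] -/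
def rhombus24PosA : Fin 7 → ℕ := ![0, 4, 7, 9, 11, 15, 18]

/-- marking B: positions `0, 4, 7, 9, 11, 18, 20`. [cite: BollobasRiordan2006, Ch. 7 §7.2.2 p. 193] -/
def rhombus24PosB : Fin 7 → ℕ := ![0, 4, 7, 9, 11, 18, 20]

/-- `rhombus24` is a disc based at `rhombus24Base`. [folklore] -/
private theorem rhombus24_isTriDisc : IsTriDisc rhombus24 rhombus24Base :=
  rhombus24Domain₀.isTriDisc.rebase (by decide)

/-- **The seven-marked 2 × 4 rhombus, marking A** (Bollobás–Riordan 2006, Ch. 7 §7.2.2 pp. 192–193): sites `rhombus24`, base dart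
`((−1,−1),(−2,−1))`, marks at positions `0, 4, 7, 9, 11, 15, 18` of the 22-dart boundary cycle, i.e. at the sites
`(−1,−1), (0,−1), (0,0), (0,1), (0,2), (−1,2), (−1,1)`. [cite: BollobasRiordan2006, Ch. 7 §7.2.2 pp. 192–193] -/
def rhombus24SevenA : TriMarkedDomain 7 where
  verts := rhombus24
  base := rhombus24Base
  pos := rhombus24PosA
  base_mem := by decide
  connected := rhombus24Domain₀.connected
  outer_connected := rhombus24Domain₀.outer_connected
  no_cut := rhombus24Domain₀.no_cut
  outer_no_cut := rhombus24Domain₀.outer_no_cut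
  euler := rhombus24_isTriDisc.euler
  cycle := rhombus24_isTriDisc.cycle
  cycle_len := rhombus24_isTriDisc.cycle_len
  pos_zero := fun _ => rfl
  pos_strictMono := by
    intro a b hab
    revert a b
    decide
  pos_lt := by decide
  mark_pred := by decide
  mark_pred_pred := by decide
  mark_injective := by
    intro a b hab
    revert a b
    decide

/-- **The seven-marked 2 × 4 rhombus, marking B**: marks at positions `0, 4, 7, 9, 11, 18, 20`, i.e. at the sites
`(−1,−1), (0,−1), (0,0), (0,1), (0,2), (−1,1), (−1,0)`. [cite: BollobasRiordan2006, Ch. 7 §7.2.2 pp. 192–193] -/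
def rhombus24SevenB : TriMarkedDomain 7 where
  verts := rhombus24
  base := rhombus24Base
  pos := rhombus24PosB
  base_mem := by decide
  connected := rhombus24Domain₀.connected
  outer_connected := rhombus24Domain₀.outer_connected
  no_cut := rhombus24Domain₀.no_cut
  outer_no_cut := rhombus24Domain₀.outer_no_cut
  euler := rhombus24_isTriDisc.euler
  cycle := rhombus24_isTriDisc.cycle
  cycle_len := rhombus24_isTriDisc.cycle_len
  pos_zero := fun _ => rfl
  pos_strictMono := by
    intro a b hab
    revert a b
    decide
  pos_lt := by decide
  mark_pred := by decide
  mark_pred_pred := by decide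
  mark_injective := by
    intro a b hab
    revert a b
    decide

/-- the site sets. [cite: BollobasRiordan2006, Ch. 7 §7.2.2 p. 192] -/
@[simp] theorem rhombus24SevenA_verts : rhombus24SevenA.verts = rhombus24 := rfl

/-- Auxiliary. [cite: BollobasRiordan2006, Ch. 7 §7.2.2 p. 192] -/
@[simp] theorem rhombus24SevenB_verts : rhombus24SevenB.verts = rhombus24 := rfl

/-- The boundary cycle of the rhombus has `22` darts. [cite: BollobasRiordan2006, Ch. 7 §7.2.2 p. 192] -/
theorem rhombus24SevenA_bdryLen : rhombus24SevenA.bdryLen = 22 := by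
  decide

/-- The marked sites of marking A: `(−1,−1), (0,−1), (0,0), (0,1), (0,2), (−1,2), (−1,1)` (anticlockwise) — seven of the eight sites.
[cite: BollobasRiordan2006, Ch. 7 §7.2.2 p. 193] -/
theorem rhombus24SevenA_markSite : ∀ i : Fin 7,
    rhombus24SevenA.markSite i = (![![-1, -1], ![0, -1], ![0, 0], ![0, 1], ![0, 2], ![-1, 2], ![-1, 1]] : Fin 7 → Site 2) i := by
  decide

/-- The marked sites of marking B: `(−1,−1), (0,−1), (0,0), (0,1), (0,2), (−1,1), (−1,0)`. [cite: BollobasRiordan2006, Ch. 7 §7.2.2 p. 193] -/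
theorem rhombus24SevenB_markSite : ∀ i : Fin 7,
    rhombus24SevenB.markSite i = (![![-1, -1], ![0, -1], ![0, 0], ![0, 1], ![0, 2], ![-1, 1], ![-1, 0]] : Fin 7 → Site 2) i := by
  decide

end Literature.Probability.Percolation

end
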